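import Literature.NumberTheory.Sieve.PolymathGEHTypeII
import Mathlib.Analysis.SpecialFunctions.Pow.Asymptotics
import HarnessLib

/-!
# Sparse pieces for `GEH[ϑ]`: prime powers in a short range satisfy the Siegel–Walfisz hypothesis trivially

Trunk AntSieve, tooling toward the named fact `Literature.NumberTheory.Sieve.weakDHL_three_two_of_GEH`
(D. H. J. Polymath, Res. Math. Sci. 1:12 (2014) = arXiv:1407.4897, Theorem 3.2(xii)).  In the
decomposition of the almost-prime weight of Theorem 3.6(ii) (§4.5, p. 17) into convolutions `α ⋆ β`
(see `PolymathGEHLayered`: the `e`-th layer has `β` = indicator of the `e`-th powers of the primes of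
one short range), the layers `e ≥ 2` are SPARSE: hypothesis (2.4) of Claim 2.6 is a bound relative to
the scale `M` of `β`, and a sequence with `|β| ≤ 1` supported on at most `#S` points has
`|Δ(β 1_{(·,r)=1}; a (q))| ≤ 2 #S` for all `q, r, a` (`abs_apDiscrepancy_le_two_mul_card`); for
`β = 1_{{p^e : m < p ≤ m'}}` (`primePowPiece e m m'`, `e ≥ 2`, `m' ≤ 2m`) this is `≤ 4m ≤ m^e (log x)^{-B}`
once `m ≥ x^{c₀}` (`primePowPiece_siegelWalfisz_uniform`).

## References

* [Polymath8b2014] D. H. J. Polymath, Res. Math. Sci. 1 (2014), Art. 12 = arXiv:1407.4897,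
  Claim 2.6 (2.4) (p. 6), §4.5 (p. 17).
-/

noncomputable section

open Finset Real Filter
open scoped ArithmeticFunction.sigma

namespace Literature.NumberTheory.Sieve

/-! ### Sparse sequences -/

/-- **Sparse sequences have small discrepancy**: if `|β| ≤ 1` and `β` vanishes off the finite set
`S`, then `|Δ(β 1_{(·,r)=1}; N; a (q))| ≤ 2 #S` (`q ≥ 1`). [folklore] -/
theorem abs_apDiscrepancy_le_two_mul_card {β : ℕ → ℝ} (hβ : ∀ n, |β n| ≤ 1) {S : Finset ℕ}
    (hS : ∀ n, β n ≠ 0 → n ∈ S) (r N : ℕ) {q : ℕ} (hq : 1 ≤ q) (a : (ZMod q)ˣ) :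
    |apDiscrepancy (fun n => if n.Coprime r then β n else 0) N q a| ≤ 2 * #S := by
  have hφ1 : (1 : ℝ) ≤ Nat.totient q := by exact_mod_cast Nat.totient_pos.2 (by omega)
  have hφ0 : (0 : ℝ) < Nat.totient q := by linarith
  -- `|d| ≤ 1_S`
  have hd : ∀ n, |(if n.Coprime r then β n else 0 : ℝ)| ≤ if n ∈ S then 1 else 0 := by
    intro n
    by_cases hc : n.Coprime r
    · rw [if_pos hc]
      by_cases hn : β n = 0
      · rw [hn, abs_zero]; split_ifs <;> norm_num
      · rw [if_pos (hS n hn)]; exact hβ n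
    · rw [if_neg hc, abs_zero]; split_ifs <;> norm_num
  have hsum : ∀ (p : ℕ → Prop) [DecidablePred p],
      |∑ n ∈ (Icc 1 N).filter p, (if n.Coprime r then β n else 0 : ℝ)| ≤ #S := by
    intro p _
    refine (Finset.abs_sum_le_sum_abs _ _).trans ?_
    calc ∑ n ∈ (Icc 1 N).filter p, |(if n.Coprime r then β n else 0 : ℝ)|
        ≤ ∑ n ∈ (Icc 1 N).filter p, (if n ∈ S then (1 : ℝ) else 0) := Finset.sum_le_sum fun n _ => hd n
      _ = #(((Icc 1 N).filter p).filter (· ∈ S)) := by rw [← Finset.sum_filter]; simp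
      _ ≤ #S := by
          exact_mod_cast Finset.card_le_card fun n hn => (Finset.mem_filter.1 hn).2
  unfold apDiscrepancy
  have h1 := hsum (fun n : ℕ => (n : ZMod q) = a)
  have h2 := hsum (fun n : ℕ => n.Coprime q)
  have h3 : |(∑ n ∈ (Icc 1 N).filter (fun n : ℕ => n.Coprime q), (if n.Coprime r then β n else 0 : ℝ)) /
      Nat.totient q| ≤ #S := by
    rw [abs_div, abs_of_pos hφ0]
    exact (div_le_self (abs_nonneg _) hφ1).trans h2
  have := abs_sub (∑ n ∈ (Icc 1 N).filter (fun n : ℕ => (n : ZMod q) = a), (if n.Coprime r then β n else 0 : ℝ))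
    ((∑ n ∈ (Icc 1 N).filter (fun n : ℕ => n.Coprime q), (if n.Coprime r then β n else 0 : ℝ)) / Nat.totient q)
  linarith

/-! ### Prime-power pieces -/

/-- The `e`-th powers of the primes in `(m, m']`, as a finite set. [folklore] -/
def primePowSet (e m m' : ℕ) : Finset ℕ := ((Ioc m m').filter Nat.Prime).image fun p => p ^ e

/-- `0` is not an `e`-th power of a prime. [folklore] -/
theorem zero_notMem_primePowSet (e m m' : ℕ) : 0 ∉ primePowSet e m m' := by
  intro h
  rw [primePowSet, Finset.mem_image] at h
  obtain ⟨p, hp, h0⟩ := h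
  have hpp : p.Prime := (Finset.mem_filter.1 hp).2
  exact hpp.ne_zero (pow_eq_zero_iff'.1 h0).1

/-- `1_{{p^e : p prime, m < p ≤ m'}}` as a real arithmetic function (the `β` of the `e`-th layer).
[cite: Polymath8b2014, §4.5, p. 17] -/
def primePowPiece (e m m' : ℕ) : ArithmeticFunction ℝ :=
  ⟨fun n => if n ∈ primePowSet e m m' then 1 else 0, by rw [if_neg (zero_notMem_primePowSet e m m')]⟩

/-- Values of the prime-power piece. [folklore] -/
theorem primePowPiece_apply (e m m' n : ℕ) :
    primePowPiece e m m' n = if n ∈ primePowSet e m m' then 1 else 0 := rfl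

/-- `|primePowPiece| ≤ 1`. [folklore] -/
theorem abs_primePowPiece_le_one (e m m' n : ℕ) : |primePowPiece e m m' n| ≤ 1 := by
  rw [primePowPiece_apply]; split_ifs <;> simp

/-- The support of the prime-power piece is `primePowSet`. [folklore] -/
theorem primePowPiece_support (e m m' n : ℕ) (h : primePowPiece e m m' n ≠ 0) : n ∈ primePowSet e m m' := by
  rw [primePowPiece_apply] at h
  by_contra hn
  exact h (if_neg hn)

/-- The support lies in `(m^e, m'^e]` (`e ≥ 1`). [folklore] -/
theorem primePowPiece_eq_zero {e m m' n : ℕ} (he : 1 ≤ e) (hn : n ≤ m ^ e ∨ m' ^ e < n) :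
    primePowPiece e m m' n = 0 := by
  rw [primePowPiece_apply, if_neg]
  intro hmem
  rw [primePowSet, Finset.mem_image] at hmem
  obtain ⟨p, hp, rfl⟩ := hmem
  have hp' := (Finset.mem_Ioc.1 (Finset.mem_filter.1 hp).1)
  rcases hn with hn | hn
  · exact absurd (Nat.pow_lt_pow_left hp'.1 (by omega)) (not_lt.2 hn)
  · exact absurd (Nat.pow_le_pow_left hp'.2 e) (not_le.2 hn)

/-- `#primePowSet e m m' ≤ m' − m`. [folklore] -/
theorem card_primePowSet_le (e m m' : ℕ) : #(primePowSet e m m') ≤ m' - m := by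
  rw [primePowSet]
  refine Finset.card_image_le.trans ((Finset.card_filter_le _ _).trans ?_)
  rw [Nat.card_Ioc]

/-- **Claim 2.6 (2.4) for the prime-power pieces, `e ≥ 2`** (trivially, by sparsity): for `c₀ > 0`,
`K ≥ 1`, `k`, `B > 0` there is `C` with, eventually in `x`, for all `e ≥ 2` and natural
`x^{c₀} ≤ m ≤ m' ≤ 2m`, all `q, r ≥ 1`, `a`, and any cut-off `N`:
`|Δ(primePowPiece e m m' · 1_{(·,r)=1}; N; a (q))| ≤ C τ(qr)^k m^e (log x)^{-B}`. [cite: Polymath8b2014, Claim 2.6 (2.4)] -/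
theorem primePowPiece_siegelWalfisz_uniform {c₀ : ℝ} (hc₀ : 0 < c₀) (k : ℕ) (B : ℝ) (hB : 0 < B) :
    ∃ C : ℝ, ∀ᶠ x : ℝ in atTop, ∀ e m m' : ℕ, 2 ≤ e → x ^ c₀ ≤ (m : ℝ) → m ≤ m' → m' ≤ 2 * m →
      ∀ N q r : ℕ, 1 ≤ q → 1 ≤ r → ∀ a : (ZMod q)ˣ,
      |apDiscrepancy (fun n => if n.Coprime r then primePowPiece e m m' n else 0) N q a|
        ≤ C * (σ 0 (q * r) : ℝ) ^ k * (m : ℝ) ^ e / Real.log x ^ B := by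
  refine ⟨4, ?_⟩
  -- eventually `log^B x ≤ x^{c₀}`
  have e1 : ∀ᶠ x : ℝ in atTop, Real.log x ^ B ≤ x ^ c₀ := by
    have := (isLittleO_log_rpow_rpow_atTop B hc₀).bound (show (0:ℝ) < 1 by norm_num)
    filter_upwards [this, eventually_ge_atTop (1 : ℝ)] with x hx hx1
    rw [one_mul, Real.norm_of_nonneg (Real.rpow_nonneg (Real.log_nonneg hx1) _),
      Real.norm_of_nonneg (Real.rpow_nonneg (by linarith) _)] at hx
    exact hx
  filter_upwards [e1, eventually_ge_atTop (Real.exp 1)] with x hx1 hx2 e m m' he hm hmm' hm'2 N q r hq hr a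
  have hx0 : 0 < x := lt_of_lt_of_le (Real.exp_pos 1) hx2
  have hlog : 1 ≤ Real.log x := by rwa [Real.le_log_iff_exp_le hx0]
  have hlog0 : 0 < Real.log x := by linarith
  have hLB : 0 < Real.log x ^ B := Real.rpow_pos_of_pos hlog0 B
  have hm1 : (1 : ℝ) ≤ m := by
    have : (1 : ℝ) ≤ Real.log x ^ B := Real.one_le_rpow hlog hB.le
    linarith
  have hmpos : (0 : ℝ) < m := by linarith
  -- sparsity: `|Δ| ≤ 2 #image ≤ 2 #(Ioc m m') ≤ 2 m' ≤ 4 m`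
  have hS := abs_apDiscrepancy_le_two_mul_card (abs_primePowPiece_le_one e m m')
    (S := primePowSet e m m') (fun n hn => primePowPiece_support e m m' n hn) r N hq a
  have hcard : (#(primePowSet e m m') : ℝ) ≤ m := by
    have h1 := card_primePowSet_le e m m'
    have : ((m' - m : ℕ) : ℝ) ≤ m := by
      have : m' - m ≤ m := by omega
      exact_mod_cast this
    exact le_trans (by exact_mod_cast h1) this
  -- `4 m ≤ 4 τ^k m^e / log^B x` since `log^B x ≤ x^{c₀} ≤ m ≤ m^{e-1}` and `τ^k ≥ 1`
  have hτ1 : (1 : ℝ) ≤ (σ 0 (q * r) : ℝ) ^ k := by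
    have : 1 ≤ σ 0 (q * r) := by
      rw [ArithmeticFunction.sigma_zero_apply]
      exact Finset.card_pos.2 ⟨1, Nat.one_mem_divisors.2 (Nat.mul_ne_zero (by omega) (by omega))⟩
    exact one_le_pow₀ (by exact_mod_cast this)
  have hme : (m : ℝ) * Real.log x ^ B ≤ (m : ℝ) ^ e := by
    have h1 : Real.log x ^ B ≤ (m : ℝ) := hx1.trans hm
    have h2 : (m : ℝ) ≤ (m : ℝ) ^ (e - 1) := by
      calc (m : ℝ) = (m : ℝ) ^ 1 := (pow_one _).symm
        _ ≤ (m : ℝ) ^ (e - 1) := pow_le_pow_right₀ hm1 (by omega)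
    calc (m : ℝ) * Real.log x ^ B ≤ (m : ℝ) * m := mul_le_mul_of_nonneg_left h1 hmpos.le
      _ ≤ (m : ℝ) * (m : ℝ) ^ (e - 1) := mul_le_mul_of_nonneg_left h2 hmpos.le
      _ = (m : ℝ) ^ e := by rw [← pow_succ', Nat.sub_add_cancel (by omega)]
  have hfinal : 2 * (#(primePowSet e m m') : ℝ) ≤ 4 * (σ 0 (q * r) : ℝ) ^ k * (m : ℝ) ^ e / Real.log x ^ B := by
    rw [le_div_iff₀ hLB]
    have h1 : 2 * (#(primePowSet e m m') : ℝ) * Real.log x ^ B ≤ 2 * ((m : ℝ) * Real.log x ^ B) := by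
      nlinarith [hLB.le]
    have h2 : (m : ℝ) ^ e ≤ (σ 0 (q * r) : ℝ) ^ k * (m : ℝ) ^ e := le_mul_of_one_le_left (by positivity) hτ1
    nlinarith [hme, pow_nonneg hmpos.le e]
  exact hS.trans hfinal

end Literature.NumberTheory.Sieve
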